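import Mathlib
import Summits.Ventures.PercRepro2.Defs
import Summits.Ventures.PercRepro2.Independence
import Summits.Ventures.PercRepro2.Harris
import Summits.Ventures.PercRepro2.Graph
import Summits.Ventures.PercRepro2.Exploration
import Summits.Ventures.PercRepro2.Events
import Summits.Ventures.PercRepro2.FourFunctions
import Summits.Ventures.PercRepro2.Induced
import Summits.Ventures.PercRepro2.Frontier
import Summits.Ventures.PercRepro2.ObsIndependence
import Summits.Ventures.PercRepro2.BHK
import Summits.Ventures.PercRepro2.BHKEvents
import Summits.Ventures.PercRepro2.MultiSource
import Summits.Ventures.PercRepro2.OrderPreservation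
import Summits.Ventures.PercRepro2.SeedSet
import Summits.Ventures.PercRepro2.MultiSourceFun
import Summits.Ventures.PercRepro2.CrossRootT
import Summits.Ventures.PercRepro2.VdBKahn
import Summits.Ventures.PercRepro2.HullDefs
import Summits.Ventures.PercRepro2.CCTRootEdge
import Summits.Ventures.PercRepro2.PASubDefs
import Summits.Ventures.PercRepro2.PASub
import Summits.Ventures.PercRepro2.HalfN

/-!
# (PA-K): the `e`-open hull functionals are positively correlated (blind cell PercRepro2, typer-1;
mine-c g3 MINE-C.md §10.4 "(PA-K) Cov_{λ₁}(x₁, y₁) ≥ 0 (theorem: BHK + decreasing)"; lead g11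
11:17:35Z row 2′CCT-LIN)

With `K⁺ = C_{ω⁺}(T)` the `e`-open seed cluster, `λ₁(W) = P(K⁺ = W)` on `{s ∉ W}` and
`x₁(W) = P(s ↔ a in G/e with the edges at W deleted)` (`HalfN.XdelP`), the decreasing functionals
`x₁, y₁` are positively correlated under the `e`-open law:

**`paK`**: `(Σ x₁ λ₁)(Σ y₁ λ₁) ≤ (Σ x₁ y₁ λ₁)(Σ λ₁)` — `bhk_multi` for the seed set `T` avoiding `{s}`
under `p[e ↦ 1]` with `1 − x₁`, `1 − y₁`, transferred by `PASub.expect_update_one_K`.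
-/

namespace Summit.Ventures.PercRepro2

namespace PAK

open PASub HalfN

open scoped Classical

variable {V : Type*} {E : Type*} [Fintype E] [DecidableEq E] [Fintype V] [DecidableEq V]
  {R : Type*} [Field R] [LinearOrder R] [IsStrictOrderedRing R]

variable (p : E → R) (ends : E → Sym2 V) (e : E) (s : V) (T : Finset V)

/-- **(PA-K)**: `Cov_{λ₁}(x₁, y₁) ≥ 0`, cleared. -/
theorem paK (hp : IsProbVec p) (a b : V) :
    (∑ W : Set V, if s ∉ W then prob p (XdelP ends e s W a) * prob p (KEvent ends e T W) else 0) *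
        (∑ W : Set V, if s ∉ W then prob p (XdelP ends e s W b) * prob p (KEvent ends e T W)
          else 0) ≤
      (∑ W : Set V, if s ∉ W then
          prob p (XdelP ends e s W a) * prob p (XdelP ends e s W b) * prob p (KEvent ends e T W)
          else 0) *
        (∑ W : Set V, if s ∉ W then prob p (KEvent ends e T W) else 0) := by
  have hp₁ : IsProbVec (Function.update p e 1) := hp.update e zero_le_one le_rfl
  have hx_anti : ∀ {W W' : Set V}, W ⊆ W' →
      prob p (XdelP ends e s W' a) ≤ prob p (XdelP ends e s W a) :=
    fun h => prob_mono hp (XdelP_anti ends e s h a)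
  have hy_anti : ∀ {W W' : Set V}, W ⊆ W' →
      prob p (XdelP ends e s W' b) ≤ prob p (XdelP ends e s W b) :=
    fun h => prob_mono hp (XdelP_anti ends e s h b)
  have key := bhk_multi (Function.update p e 1) hp₁ ends T
    (F₁ := fun W => 1 - prob p (XdelP ends e s W a))
    (F₂ := fun W => 1 - prob p (XdelP ends e s W b))
    (fun W W' h => by simp only; linarith [hx_anti h])
    (fun W W' h => by simp only; linarith [hy_anti h])
    (fun W => sub_nonneg.2 (prob_le_one hp _)) (fun W => sub_nonneg.2 (prob_le_one hp _)) {s} {s}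
  rw [Finset.inter_self, Finset.union_self,
    expect_update_one_K p ends e s T (fun W => 1 - prob p (XdelP ends e s W a)),
    expect_update_one_K p ends e s T (fun W => 1 - prob p (XdelP ends e s W b)),
    expect_update_one_K p ends e s T
      ((fun W => 1 - prob p (XdelP ends e s W a)) * fun W => 1 - prob p (XdelP ends e s W b))]
    at key
  simp only [Pi.mul_apply] at key
  -- the total mass
  have hR : prob (Function.update p e 1) (avoidAllT ends T {s}) =
      ∑ W : Set V, if s ∉ W then prob p (KEvent ends e T W) else 0 := by
    have := expect_update_one_K p ends e s T (fun _ => (1 : R))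
    simp only [one_mul] at this
    rw [← this, prob_eq_expect_indicator]
  rw [hR] at key
  set S := ∑ W : Set V, if s ∉ W then prob p (KEvent ends e T W) else 0 with hS
  set Sx := ∑ W : Set V, if s ∉ W then prob p (XdelP ends e s W a) * prob p (KEvent ends e T W)
    else 0 with hSx
  set Sy := ∑ W : Set V, if s ∉ W then prob p (XdelP ends e s W b) * prob p (KEvent ends e T W)
    else 0 with hSy
  set Sxy := ∑ W : Set V, if s ∉ W then
    prob p (XdelP ends e s W a) * prob p (XdelP ends e s W b) * prob p (KEvent ends e T W) else 0
    with hSxy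
  have e1 : (∑ W : Set V, if s ∉ W then (1 - prob p (XdelP ends e s W a)) *
      prob p (KEvent ends e T W) else 0) = S - Sx := by
    rw [hS, hSx, ← Finset.sum_sub_distrib]
    refine Finset.sum_congr rfl fun W _ => ?_
    split_ifs <;> ring
  have e2 : (∑ W : Set V, if s ∉ W then (1 - prob p (XdelP ends e s W b)) *
      prob p (KEvent ends e T W) else 0) = S - Sy := by
    rw [hS, hSy, ← Finset.sum_sub_distrib]
    refine Finset.sum_congr rfl fun W _ => ?_
    split_ifs <;> ring
  have e3 : (∑ W : Set V, if s ∉ W then (1 - prob p (XdelP ends e s W a)) *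
      (1 - prob p (XdelP ends e s W b)) * prob p (KEvent ends e T W) else 0) =
      S - Sx - Sy + Sxy := by
    rw [hS, hSx, hSy, hSxy, ← Finset.sum_sub_distrib, ← Finset.sum_sub_distrib,
      ← Finset.sum_add_distrib]
    refine Finset.sum_congr rfl fun W _ => ?_
    split_ifs <;> ring
  rw [e1, e2, e3] at key
  nlinarith [key]

end PAK

end Summit.Ventures.PercRepro2
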